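/-
Copyright (c) 2026. All rights reserved.
Released under Apache 2.0 license as described in the file LICENSE.
-/
import Mathlib
import Literature.RingTheory.ZeroDimensional.HermiteFormReal
import HarnessLib

/-!
# The Hermite form of a real zero-dimensional ideal, II: Theorem 4.99 and the rank over `ℝ`
(BPR2006 §4.6 Theorem 4.99 for `K = R = ℝ`, `C = ℂ`; Laurent2008 Theorem 2.14 (i) as a rank,
Theorem 2.1 (i))

[cite: BasuPollackRoy2006, §4.6 Theorem 4.99 ("√Ideal(P, K) = Rad(Her(P))") and its proof
(Equality (4.9)), p. 192; Theorem 4.100 (first identity), pp. 192–193]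
[cite: Laurent2008, §2.1 Theorem 2.1 (i) ("(Hilbert's Nullstellensatz) √I = I(V_ℂ(I))",
I ⊆ ℝ[x]), p. 12; §2.4.4 Theorem 2.14 (first identity "rank(S_h) = |{v ∈ V_ℂ(I) | h(v) ≠ 0}|")
and Corollary 2.15 ("rank(S_1) = |V_ℂ(I)|"), pp. 24–26]

Continuation of `Literature.RingTheory.ZeroDimensional.HermiteFormReal` (Theorem 2.14 / 4.100 over
`ℝ` with complex-conjugate root pairs, via the inertia indices `σ±`).  This leaf adds, for a real
zero-dimensional ideal `I ⊆ ℝ[x]` with NO hypothesis on the roots (the tree's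
`HermiteForm` `CharZero` section needs all roots `K`-rational, hypothesis (hK)):

* `mem_ker_traceForm_compLeft_mulLeft_iff` — **`Ker S_h = {a ∈ A | a(v) = 0 for all v ∈ V_ℂ(I)
  with h(v) ≠ 0}`** (test `a` against the element `b ∈ A` with the conjugation-symmetric values
  `b(v) = conj(h(v) a(v))`, supplied by `HermiteFormReal.exists_evalAt_eq`, so that
  `S_h(a, b) = Σ_v mult(v) |h(v) a(v)|²`);
* `finrank_range_traceForm_compLeft_mulLeft` — **Theorem 2.14 (i) / Theorem 4.100 (i) as a RANK:
  `dim range(S_h) = |{v ∈ V_ℂ(I) | h(v) ≠ 0}|`** (the kernel of the symmetric form `S_h` is the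
  radical of its quadratic form, whose dimension is `HermiteFormReal.finrank_radical_eq`);
* `isNilpotent_iff_forall_evalAt_eq_zero`, `radical_eq_vanishingIdeal_zeroLocus` — **Laurent's
  Theorem 2.1 (i) `√I = I(V_ℂ(I))`** for a real ZERO-DIMENSIONAL `I` and any index type `σ`, read
  through `A ⊂ Ā = ℂ[x]/I_ℂ` (`HermiteFormReal.toComplex_injective`) and the tree's `K`-rational
  Nullstellensatz `HermiteForm.isNilpotent_iff_evalPi_eq_zero` over `ℂ` (Mathlib's
  `MvPolynomial.vanishingIdeal_zeroLocus_eq_radical` is the general statement for `Finite σ`);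
* **Theorem 4.99 over `ℝ`**: `mem_ker_traceForm_iff_isNilpotent` (`Rad(Her(P)) = √I/I`),
  `mk_mem_ker_traceForm_iff_mem_radical`, `traceForm_nondegenerate_iff_isRadical` (**the trace form
  of `ℝ[x]/I` is nondegenerate iff `I` is radical**), and `finrank_range_traceForm`
  (**Corollary 2.15: `rank(S_1) = |V_ℂ(I)|`**).
-/

noncomputable section

namespace Literature.RingTheory.ZeroDimensional.HermiteFormRealRadical

open _root_.MvPolynomial Module Module.End
open scoped ComplexConjugate
open Literature.RingTheory.ZeroDimensional.Multiplicity
open Literature.RingTheory.ZeroDimensional.HermiteForm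
open Literature.RingTheory.ZeroDimensional.HermiteFormReal

variable {σ : Type*} (I : Ideal (MvPolynomial σ ℝ)) [FiniteDimensional ℝ (MvPolynomial σ ℝ ⧸ I)]
  [Fintype (zeroLocus ℂ I)]

omit [FiniteDimensional ℝ (MvPolynomial σ ℝ ⧸ I)] [Fintype (zeroLocus ℂ I)] in
/-- `S_h` is symmetric: `Tr(M_h a b) = Tr(M_h b a)`. [cite: Laurent2008, §2.4.4 ("the following
symmetric bilinear form … S_h"), p. 24] -/
theorem traceForm_compLeft_mulLeft_comm (h : MvPolynomial σ ℝ) (a b : MvPolynomial σ ℝ ⧸ I) :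
    (Algebra.traceForm ℝ (MvPolynomial σ ℝ ⧸ I)).compLeft
        (LinearMap.mulLeft ℝ (Ideal.Quotient.mk I h)) a b =
      (Algebra.traceForm ℝ (MvPolynomial σ ℝ ⧸ I)).compLeft
        (LinearMap.mulLeft ℝ (Ideal.Quotient.mk I h)) b a := by
  rw [LinearMap.BilinForm.compLeft_apply, LinearMap.BilinForm.compLeft_apply,
    LinearMap.mulLeft_apply, LinearMap.mulLeft_apply, Algebra.traceForm_apply,
    Algebra.traceForm_apply, mul_right_comm]

omit [FiniteDimensional ℝ (MvPolynomial σ ℝ ⧸ I)] [Fintype (zeroLocus ℂ I)] in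
/-- The kernel of the (symmetric) bilinear form `S_h` is the radical of its quadratic form
(`char ℝ ≠ 2`). [folklore] -/
private theorem ker_traceForm_compLeft_mulLeft_eq_radical (h : MvPolynomial σ ℝ) :
    LinearMap.ker ((Algebra.traceForm ℝ (MvPolynomial σ ℝ ⧸ I)).compLeft
        (LinearMap.mulLeft ℝ (Ideal.Quotient.mk I h))) =
      (((Algebra.traceForm ℝ (MvPolynomial σ ℝ ⧸ I)).compLeft
        (LinearMap.mulLeft ℝ (Ideal.Quotient.mk I h))).toQuadraticMap).radical := by
  haveI : Invertible (2 : ℝ) := invertibleOfNonzero two_ne_zero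
  rw [QuadraticMap.radical_eq_ker_polarBilin, LinearMap.BilinMap.polarBilin_toQuadraticMap]
  ext a
  simp only [LinearMap.mem_ker, LinearMap.ext_iff, LinearMap.add_apply, LinearMap.flip_apply,
    LinearMap.zero_apply]
  constructor
  · intro H b
    rw [H b, traceForm_compLeft_mulLeft_comm I h b a, H b, add_zero]
  · intro H b
    have hb := H b
    rw [traceForm_compLeft_mulLeft_comm I h b a, ← two_mul] at hb
    exact (mul_eq_zero.1 hb).resolve_left two_ne_zero

/-- **Theorem 2.14, first identity, as a RANK: `rank(S_h) = dim range(S_h) =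
|{v ∈ V_ℂ(I) | h(v) ≠ 0}|`** for every real zero-dimensional ideal (BPR:
`Rank(Her(P, Q)) = #{x ∈ Zer(P, C^k) | Q(x) ≠ 0}`; no hypothesis on the roots).
[cite: Laurent2008, §2.4.4 Theorem 2.14 (first identity), p. 24; BasuPollackRoy2006, §4.6
Theorem 4.100 [Multivariate Hermite] (first identity), pp. 192–193] -/
theorem finrank_range_traceForm_compLeft_mulLeft (h : MvPolynomial σ ℝ)
    [DecidablePred fun v : zeroLocus ℂ I => aeval (v : σ → ℂ) h = 0] :
    finrank ℝ (LinearMap.range ((Algebra.traceForm ℝ (MvPolynomial σ ℝ ⧸ I)).compLeft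
        (LinearMap.mulLeft ℝ (Ideal.Quotient.mk I h)))) =
      Fintype.card {v : zeroLocus ℂ I // ¬ aeval (v : σ → ℂ) h = 0} := by
  have h1 := LinearMap.finrank_range_add_finrank_ker ((Algebra.traceForm ℝ (MvPolynomial σ ℝ ⧸ I)).compLeft
    (LinearMap.mulLeft ℝ (Ideal.Quotient.mk I h)))
  rw [ker_traceForm_compLeft_mulLeft_eq_radical, finrank_radical_eq I h] at h1
  rw [Fintype.card_subtype_compl]
  have h2 := Fintype.card_subtype_le fun v : zeroLocus ℂ I => aeval (v : σ → ℂ) h = 0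
  have h3 := card_zeroLocus_le_finrank I
  omega

/-- **The kernel of `S_h` over `ℝ`: `a ⊥ A` for `S_h` iff `a(v) = 0` at every complex root
`v ∈ V_ℂ(I)` with `h(v) ≠ 0`** — test against the element `b ∈ A` with the conjugation-symmetric
values `b(v) = conj(h(v) a(v))`, so that `S_h(a, b) = Σ_v mult(v) |h(v) a(v)|²`.
[cite: Laurent2008, §2.4.4 proof of Theorem 2.14 ("{w₁, …, w_r} form a basis of Ker(S_h)",
"rank of S_h … the number of v ∈ V_ℂ(I) with h(v) ≠ 0"), pp. 25–26; BasuPollackRoy2006, §4.6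
proof of Theorem 4.99 (Equality (4.9)), p. 192] -/
theorem mem_ker_traceForm_compLeft_mulLeft_iff (h : MvPolynomial σ ℝ) (a : MvPolynomial σ ℝ ⧸ I) :
    a ∈ LinearMap.ker ((Algebra.traceForm ℝ (MvPolynomial σ ℝ ⧸ I)).compLeft
        (LinearMap.mulLeft ℝ (Ideal.Quotient.mk I h))) ↔
      ∀ v : zeroLocus ℂ I, aeval (v : σ → ℂ) h ≠ 0 → evalAt I v a = 0 := by
  constructor
  · intro ha v hv
    obtain ⟨b, hb⟩ := exists_evalAt_eq I
      (fun w => conj (aeval (w : σ → ℂ) h * evalAt I w a)) fun w => by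
        simp only [aeval_conjRoot, evalAt_conjRoot, map_mul]
    have h0 : (Algebra.traceForm ℝ (MvPolynomial σ ℝ ⧸ I)).compLeft
        (LinearMap.mulLeft ℝ (Ideal.Quotient.mk I h)) a b = 0 := by
      rw [LinearMap.mem_ker] at ha
      rw [ha, LinearMap.zero_apply]
    have h1 := traceForm_compLeft_mulLeft_apply I h a b
    rw [h0, Complex.ofReal_zero] at h1
    have h2 : ∀ w : zeroLocus ℂ I, (mult (complexify I) (w : σ → ℂ) : ℂ) *
        (aeval (w : σ → ℂ) h * (evalAt I w a * evalAt I w b)) =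
          ((mult (complexify I) (w : σ → ℂ) *
            Complex.normSq (aeval (w : σ → ℂ) h * evalAt I w a) : ℝ) : ℂ) := by
      intro w
      rw [hb, ← mul_assoc (aeval (w : σ → ℂ) h), Complex.mul_conj, Complex.ofReal_mul,
        Complex.ofReal_natCast]
    simp_rw [h2] at h1
    rw [← Complex.ofReal_sum, eq_comm, Complex.ofReal_eq_zero] at h1
    have h3 := (Finset.sum_eq_zero_iff_of_nonneg fun w _ =>
      mul_nonneg (Nat.cast_nonneg _) (Complex.normSq_nonneg _)).1 h1 v (Finset.mem_univ v)
    rcases mul_eq_zero.1 h3 with hμ | hn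
    · exact absurd hμ (Nat.cast_ne_zero.2 (by have := one_le_mult I v; omega))
    · rw [Complex.normSq_eq_zero, mul_eq_zero] at hn
      exact hn.resolve_left hv
  · intro H
    rw [LinearMap.mem_ker]
    refine LinearMap.ext fun b => ?_
    rw [LinearMap.zero_apply]
    apply Complex.ofReal_injective
    rw [traceForm_compLeft_mulLeft_apply, Complex.ofReal_zero]
    refine Finset.sum_eq_zero fun w _ => ?_
    by_cases hw : aeval (w : σ → ℂ) h = 0
    · rw [hw, zero_mul, mul_zero]
    · rw [H w hw, zero_mul, mul_zero, mul_zero]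

omit [FiniteDimensional ℝ (MvPolynomial σ ℝ ⧸ I)] [Fintype (zeroLocus ℂ I)] in
/-- `ζ` on `Ā` restricted to `A`: `evalPi(Ā)(toComplex a)_v = a(v)`. [folklore] -/
private theorem evalPi_toComplex (a : MvPolynomial σ ℝ ⧸ I) (v : σ → ℂ)
    (hv : v ∈ zeroLocus ℂ (complexify I)) (hv' : v ∈ zeroLocus ℂ I) :
    evalPi (complexify I) (toComplex I a) ⟨v, hv⟩ = evalAt I ⟨v, hv'⟩ a := by
  obtain ⟨f, rfl⟩ := Ideal.Quotient.mk_surjective a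
  rw [toComplex_mk, evalPi_mk, evalAt_mk, MvPolynomial.eval_map, MvPolynomial.aeval_def]

omit [Fintype (zeroLocus ℂ I)] in
/-- **`a ∈ A = ℝ[x]/I` is nilpotent iff `a` vanishes on `V_ℂ(I)`** (Hilbert's Nullstellensatz for
a real zero-dimensional ideal, read through `A ⊂ Ā` and the tree's `K`-rational Nullstellensatz
`HermiteForm.isNilpotent_iff_evalPi_eq_zero` over `ℂ`; no finiteness of `σ` needed).
[cite: Laurent2008, §2.1 Theorem 2.1 (i) ("√I = I(V_ℂ(I))", I ⊆ ℝ[x]), p. 12;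
BasuPollackRoy2006, §4.6 proof of Theorem 4.96/4.99 (Hilbert's Nullstellensatz), pp. 191–192] -/
theorem isNilpotent_iff_forall_evalAt_eq_zero (a : MvPolynomial σ ℝ ⧸ I) :
    IsNilpotent a ↔ ∀ v : zeroLocus ℂ I, evalAt I v a = 0 := by
  haveI := finiteDimensional_complexify I
  have key : IsNilpotent a ↔ IsNilpotent (toComplex I a) := by
    constructor
    · exact fun ha => ha.map (toComplex I)
    · rintro ⟨n, hn⟩
      exact ⟨n, toComplex_injective I (by rw [map_pow, hn, map_zero])⟩
  rw [key, HermiteForm.isNilpotent_iff_evalPi_eq_zero (complexify I)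
    (fun i => iSup_maxGenEigenspace_mulLeft_eq_top (complexify I) _), funext_iff]
  constructor
  · intro H v
    have hv : (v : σ → ℂ) ∈ zeroLocus ℂ (complexify I) := by
      rw [zeroLocus_complexify]; exact v.2
    have := H ⟨v, hv⟩
    rwa [Pi.zero_apply, evalPi_toComplex I a v hv v.2] at this
  · intro H v
    have hv' : (v : σ → ℂ) ∈ zeroLocus ℂ I := by
      rw [← zeroLocus_complexify]; exact v.2
    rw [Pi.zero_apply, evalPi_toComplex I a v v.2 hv']
    exact H ⟨v, hv'⟩

omit [Fintype (zeroLocus ℂ I)] in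
/-- **Hilbert's Nullstellensatz for a real zero-dimensional ideal: `√I = I(V_ℂ(I))`** (Laurent's
Theorem 2.1 (i) for `I ⊆ ℝ[x]` with `ℝ[x]/I` finite dimensional; Mathlib's
`MvPolynomial.vanishingIdeal_zeroLocus_eq_radical` is the general statement for finitely many
variables). [cite: Laurent2008, §2.1 Theorem 2.1 (i), p. 12] -/
theorem radical_eq_vanishingIdeal_zeroLocus : I.radical = vanishingIdeal ℝ (zeroLocus ℂ I) := by
  ext f
  rw [Ideal.mem_radical_iff, mem_vanishingIdeal_iff]
  have h1 : (∃ n : ℕ, f ^ n ∈ I) ↔ IsNilpotent (Ideal.Quotient.mk I f) :=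
    ⟨fun ⟨n, hn⟩ => ⟨n, by rw [← map_pow, Ideal.Quotient.eq_zero_iff_mem]; exact hn⟩,
      fun ⟨n, hn⟩ => ⟨n, by rwa [← map_pow, Ideal.Quotient.eq_zero_iff_mem] at hn⟩⟩
  rw [h1, isNilpotent_iff_forall_evalAt_eq_zero]
  exact ⟨fun H v hv => by rw [← evalAt_mk I ⟨v, hv⟩]; exact H ⟨v, hv⟩,
    fun H v => by rw [evalAt_mk]; exact H v v.2⟩

/-- **Theorem 4.99 over `ℝ`: `Rad(Her(P)) = √I / I`** — the radical of the trace form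
`(a, b) ↦ Tr(M_{ab})` of `A = ℝ[x]/I` is exactly the set of nilpotent elements, for every real
zero-dimensional `I` (complex roots allowed; the tree's `HermiteForm.mem_ker_traceForm_iff_isNilpotent`
needs all roots `K`-rational). [cite: BasuPollackRoy2006, §4.6 Theorem 4.99
"√Ideal(P, K) = Rad(Her(P))", p. 192] -/
theorem mem_ker_traceForm_iff_isNilpotent (a : MvPolynomial σ ℝ ⧸ I) :
    a ∈ LinearMap.ker (Algebra.traceForm ℝ (MvPolynomial σ ℝ ⧸ I)) ↔ IsNilpotent a := by
  have h1 := mem_ker_traceForm_compLeft_mulLeft_iff I (1 : MvPolynomial σ ℝ) a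
  rw [map_one, LinearMap.mulLeft_one, LinearMap.BilinForm.compLeft_id] at h1
  rw [h1, isNilpotent_iff_forall_evalAt_eq_zero]
  exact ⟨fun H v => H v (by rw [map_one]; exact one_ne_zero), fun H v _ => H v⟩

/-- Theorem 4.99 on the polynomial side, over `ℝ`: **`Tr(M_{fg}) = 0` for all `g ∈ ℝ[x]` iff
`f ∈ √I`**. [cite: BasuPollackRoy2006, §4.6 Theorem 4.99, p. 192] -/
theorem mk_mem_ker_traceForm_iff_mem_radical (f : MvPolynomial σ ℝ) :
    Ideal.Quotient.mk I f ∈ LinearMap.ker (Algebra.traceForm ℝ (MvPolynomial σ ℝ ⧸ I)) ↔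
      f ∈ I.radical := by
  rw [mem_ker_traceForm_iff_isNilpotent, Ideal.mem_radical_iff]
  exact ⟨fun ⟨n, hn⟩ => ⟨n, by rwa [← map_pow, Ideal.Quotient.eq_zero_iff_mem] at hn⟩,
    fun ⟨n, hn⟩ => ⟨n, by rw [← map_pow, Ideal.Quotient.eq_zero_iff_mem]; exact hn⟩⟩

/-- **The trace form of `ℝ[x]/I` is nondegenerate iff `I` is radical** (Theorem 4.99 over `ℝ`:
`Rad(Her(P)) = √I/I = 0 ⟺ I = √I`; complex roots allowed).
[cite: BasuPollackRoy2006, §4.6 Theorem 4.99, p. 192; Laurent2008, §2.4.4 Corollary 2.15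
("rank(S_1) = |V_ℂ(I)|", = N iff I radical), p. 26] -/
theorem traceForm_nondegenerate_iff_isRadical :
    (Algebra.traceForm ℝ (MvPolynomial σ ℝ ⧸ I)).Nondegenerate ↔ I.IsRadical := by
  rw [LinearMap.BilinForm.nondegenerate_iff_ker_eq_bot, Ideal.isRadical_iff_quotient_reduced,
    Submodule.eq_bot_iff]
  constructor
  · intro H
    exact ⟨fun a ha => H a ((mem_ker_traceForm_iff_isNilpotent I a).2 ha)⟩
  · intro H a ha
    haveI := H
    exact ((mem_ker_traceForm_iff_isNilpotent I a).1 ha).eq_zero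

/-- **Corollary 2.15, rank as `dim range`: `rank(S_1) = |V_ℂ(I)|`** for every real zero-dimensional
ideal — the rank of the trace form of `ℝ[x]/I` counts the distinct COMPLEX roots, and
`dim A − rank(S_1) = Σ_v (mult(v) − 1)`. [cite: Laurent2008, §2.4.4 Corollary 2.15
("rank(S_1) = |V_ℂ(I)|"), p. 26] -/
theorem finrank_range_traceForm :
    finrank ℝ (LinearMap.range (Algebra.traceForm ℝ (MvPolynomial σ ℝ ⧸ I))) =
      Fintype.card (zeroLocus ℂ I) := by
  classical
  have h1 := finrank_range_traceForm_compLeft_mulLeft I (1 : MvPolynomial σ ℝ)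
  rw [map_one, LinearMap.mulLeft_one, LinearMap.BilinForm.compLeft_id] at h1
  rw [h1, Fintype.card_subtype, Finset.filter_true_of_mem fun v _ => by
    rw [map_one]; exact one_ne_zero, Finset.card_univ]

end Literature.RingTheory.ZeroDimensional.HermiteFormRealRadical
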